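import Summits.ValiantsHypothesis.ValiantsHypothesis.Theorems.LacunarySymmetroidMatrixDescartesCensusFullAlternation
import Summits.ValiantsHypothesis.ValiantsHypothesis.Theorems.LacunarySymmetroidMatrixDescartesCensusGram
import Summits.ValiantsHypothesis.ValiantsHypothesis.Theorems.LacunarySymmetroidMatrixDescartesCensusSupportDescartes

/-!
# `MatrixDescartes` census — C22: the SIGN-CLASS support certificate at `m = 2` as a kernel theorem schema

HONEST FRAMING.  Object-search cell `pub-symmetroid`, route crux `Theses.LacunarySymmetroid.MatrixDescartes`
(ledger item stmt-ValiantsHypothesis-18050).  DATA-CUT item (b) of the cell is a TABLE of support-level upper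
bounds «`ζ(2,6;d) ≤ ?`»; its layer 1 is the sign-class (parity–Minkowski) certificate C22 (STRUCTURE.md §1.1;
LAYER1-SIGNCLASS-lead.md; four independent implementations agree on 4 586 certified supports in the box `d₅ ≤ 40`).
This file makes the certificate a KERNEL THEOREM SCHEMA whose hypotheses are decidable data about `d`, so that
each table line is an instance by `decide`:

* the dictionary F0 in polynomial form — `det_pencil_two_eq_sum_pairs`, `coeff_det_pencil_two`, and on UNCOLLIDED
  exponents `coeff_det_pencil_two_diag` (`c_{2dᵢ} = det Sᵢ`) / `coeff_det_pencil_two_pair` (`c_{dᵢ+dⱼ} = 2B(Sᵢ,Sⱼ)`);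
* the sign facts behind F2/F3 (tree: `two_by_two_det_pos_iff_definite`, `polarDet_pos_of_posDef`) packaged as
  `mul_mul_polarDet_pos` (`sign B(S,T) = σ_S σ_T` for definite `S, T`) and the TRIANGLE OBSTRUCTION
  `polarDet_triangle_pos` (`B(S,T)·B(T,U)·B(S,U) > 0` for three definite letters);
* F1 from `…CensusFullAlternation.lean` (`sign c_e = s·(−1)^{rank e}` for a Descartes-sharp polynomial);
* the schema `card_posRoots_add_two_le_of_signClass`: two «odd definite triangles» (one for each global sign `s`)
  on uncollided exponents ⇒ `#Z₊(det F) + 2 ≤ #(pair sums)`, i.e. `ζ(2,K;d) ≤ D(d) − 1`; and the worked example of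
  LAYER1-SIGNCLASS-lead.md, `posRoots_le_19_on_2_6_0_2_5_11_18_28` (16 `decide`s, < 1 s).

What is NOT here: layer 2 (hyperbolic incidence, L-pair/L-tri), odd cycles longer than triangles (needed only on
some collided supports), magnitudes (C25 is in `…CensusNewtonCone.lean`), any `m ≥ 3` analogue (none exists from
signs alone, STRUCTURE C22), anything about the crux `MatrixDescartes` or `VP ≠ VNP`.

[folklore] Elementary `2 × 2` algebra + Descartes' rule of signs; the certificate is the cell's (lead g3 R69.2).
-/

-- `Summit.ValiantsHypothesis.ValiantsHypothesis.…` repeats a component by the D-0017 layout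
-- (single-conjunct summit), which the `dupNamespace` linter flags; the name is mandated.
set_option linter.dupNamespace false

namespace Summit.ValiantsHypothesis.ValiantsHypothesis.Theorems.LacunarySymmetroidMatrixDescartes.Census

open Polynomial Finset
open scoped BigOperators Polynomial Matrix

/-- Entries of a `2 × 2` polynomial pencil: `(∑ l, X^(d l) • C(S l)) i j = ∑ l, X^(d l) * C (S l i j)`. [folklore] -/
theorem pencil_map_C_apply {m K : ℕ} (d : Fin K → ℕ) (S : Fin K → Matrix (Fin m) (Fin m) ℝ) (i j : Fin m) :
    (∑ l, ((X : ℝ[X]) ^ d l) • (S l).map C) i j = ∑ l, (X : ℝ[X]) ^ d l * C (S l i j) := by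
  simp [Matrix.sum_apply, Matrix.smul_apply, smul_eq_mul]

/-- **F0, polynomial form.**  At `m = 2`, `det (∑ l, X^(d l) • S l) = ∑_{(l,l')} (S l ₀₀ S l' ₁₁ − S l ₀₁ S l' ₁₀) X^(d l + d l')`
as an identity of polynomials (the evaluated form is `det_pencil_two_eq_pairSum`). [folklore] -/
theorem det_pencil_two_eq_sum_pairs {K : ℕ} (d : Fin K → ℕ) (S : Fin K → Matrix (Fin 2) (Fin 2) ℝ) :
    (∑ l, ((X : ℝ[X]) ^ d l) • (S l).map C).det
      = ∑ p : Fin K × Fin K, C (S p.1 0 0 * S p.2 1 1 - S p.1 0 1 * S p.2 1 0) * X ^ (d p.1 + d p.2) := by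
  rw [Matrix.det_fin_two, pencil_map_C_apply, pencil_map_C_apply, pencil_map_C_apply, pencil_map_C_apply,
    Finset.sum_mul_sum, Finset.sum_mul_sum, ← Finset.sum_sub_distrib, Fintype.sum_prod_type]
  refine Finset.sum_congr rfl fun l _ => ?_
  rw [← Finset.sum_sub_distrib]
  refine Finset.sum_congr rfl fun l' _ => ?_
  simp only [map_sub, map_mul, pow_add]
  ring

/-- Coefficient extraction at `m = 2`: `coeff (det F) e = ∑_{d l + d l' = e} (S l ₀₀ S l' ₁₁ − S l ₀₁ S l' ₁₀)`. [folklore] -/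
theorem coeff_det_pencil_two {K : ℕ} (d : Fin K → ℕ) (S : Fin K → Matrix (Fin 2) (Fin 2) ℝ) (e : ℕ) :
    (∑ l, ((X : ℝ[X]) ^ d l) • (S l).map C).det.coeff e
      = ∑ p ∈ (Finset.univ : Finset (Fin K × Fin K)).filter (fun p => d p.1 + d p.2 = e),
          (S p.1 0 0 * S p.2 1 1 - S p.1 0 1 * S p.2 1 0) := by
  rw [det_pencil_two_eq_sum_pairs, finsetSum_coeff, Finset.sum_filter]
  refine Finset.sum_congr rfl fun p _ => ?_
  rw [coeff_C_mul, coeff_X_pow]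
  split_ifs with h1 h2 h2
  · rw [mul_one]
  · exact absurd h1.symm h2
  · exact absurd h2.symm h1
  · rw [mul_zero]

/-- The DIAGONAL letter of the dictionary: on an uncollided exponent `2·d i` the coefficient of `det F` is
`det S i` (`= S i ₀₀ S i ₁₁ − S i ₀₁ S i ₁₀`). [folklore] -/
theorem coeff_det_pencil_two_diag {K : ℕ} (d : Fin K → ℕ) (S : Fin K → Matrix (Fin 2) (Fin 2) ℝ) (i : Fin K)
    (huniq : ∀ p : Fin K × Fin K, d p.1 + d p.2 = d i + d i → p = (i, i)) :
    (∑ l, ((X : ℝ[X]) ^ d l) • (S l).map C).det.coeff (d i + d i)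
      = S i 0 0 * S i 1 1 - S i 0 1 * S i 1 0 := by
  rw [coeff_det_pencil_two]
  have : (Finset.univ : Finset (Fin K × Fin K)).filter (fun p => d p.1 + d p.2 = d i + d i) = {(i, i)} := by
    ext p
    simp only [Finset.mem_filter, Finset.mem_univ, true_and, Finset.mem_singleton]
    exact ⟨huniq p, fun h => by rw [h]⟩
  rw [this, Finset.sum_singleton]

/-- The PAIR letter of the dictionary: on an uncollided exponent `d i + d j` (`i ≠ j`) the coefficient of
`det F` is the symmetrised mixed term `2·B(S i, S j)` (`= S i ₀₀ S j ₁₁ − S i ₀₁ S j ₁₀ + S j ₀₀ S i ₁₁ − S j ₀₁ S i ₁₀`).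
[folklore] -/
theorem coeff_det_pencil_two_pair {K : ℕ} (d : Fin K → ℕ) (S : Fin K → Matrix (Fin 2) (Fin 2) ℝ)
    {i j : Fin K} (hij : i ≠ j)
    (huniq : ∀ p : Fin K × Fin K, d p.1 + d p.2 = d i + d j → p = (i, j) ∨ p = (j, i)) :
    (∑ l, ((X : ℝ[X]) ^ d l) • (S l).map C).det.coeff (d i + d j)
      = (S i 0 0 * S j 1 1 - S i 0 1 * S j 1 0) + (S j 0 0 * S i 1 1 - S j 0 1 * S i 1 0) := by
  rw [coeff_det_pencil_two]
  have hne : (i, j) ≠ (j, i) := by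
    intro h; exact hij (Prod.mk.inj h).1
  have : (Finset.univ : Finset (Fin K × Fin K)).filter (fun p => d p.1 + d p.2 = d i + d j)
      = {(i, j), (j, i)} := by
    ext p
    simp only [Finset.mem_filter, Finset.mem_univ, true_and, Finset.mem_insert, Finset.mem_singleton]
    refine ⟨huniq p, ?_⟩
    rintro (h | h) <;> rw [h]
    show d j + d i = d i + d j
    rw [add_comm]
  rw [this, Finset.sum_pair hne]

/-- Sign of the polarised determinant between two DEFINITE symmetric `2 × 2` matrices `[[a,b],[b,c]]`,
`[[a',b'],[b',c']]` (`det > 0` each): `sign (a c' + c a' − 2 b b') = sign a · sign a'` (from F2/F3). [folklore] -/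
theorem mul_mul_polarDet_pos (a b c a' b' c' : ℝ) (hS : 0 < a * c - b ^ 2) (hT : 0 < a' * c' - b' ^ 2) :
    0 < a * a' * (a * c' + c * a' - 2 * (b * b')) := by
  rcases (two_by_two_det_pos_iff_definite a b c).mp hS with ⟨ha, hc, hb⟩ | ⟨ha, hc, hb⟩ <;>
    rcases (two_by_two_det_pos_iff_definite a' b' c').mp hT with ⟨ha', hc', hb'⟩ | ⟨ha', hc', hb'⟩
  · exact mul_pos (mul_pos ha ha') (polarDet_pos_of_posDef a b c a' b' c' ha hc hb ha' hc' hb')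
  · have h := polarDet_pos_of_posDef a b c (-a') (-b') (-c') ha hc hb (by linarith) (by linarith) (by nlinarith)
    nlinarith [mul_pos ha (neg_pos.mpr ha')]
  · have h := polarDet_pos_of_posDef (-a) (-b) (-c) a' b' c' (by linarith) (by linarith) (by nlinarith) ha' hc' hb'
    nlinarith [mul_pos (neg_pos.mpr ha) ha']
  · have h := polarDet_pos_of_posDef (-a) (-b) (-c) (-a') (-b') (-c') (by linarith) (by linarith) (by nlinarith)
      (by linarith) (by linarith) (by nlinarith)
    nlinarith [mul_pos (neg_pos.mpr ha) (neg_pos.mpr ha')]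

/-- **The triangle obstruction.**  Three pairwise polarised determinants of three DEFINITE symmetric `2 × 2`
matrices have positive product (each has sign `σ_i σ_j`, `σ` = definiteness type). [folklore] -/
theorem polarDet_triangle_pos (a b c a' b' c' a'' b'' c'' : ℝ) (hS : 0 < a * c - b ^ 2)
    (hT : 0 < a' * c' - b' ^ 2) (hU : 0 < a'' * c'' - b'' ^ 2) :
    0 < (a * c' + c * a' - 2 * (b * b')) * (a' * c'' + c' * a'' - 2 * (b' * b'')) *
      (a * c'' + c * a'' - 2 * (b * b'')) := by
  have h1 := mul_mul_polarDet_pos a b c a' b' c' hS hT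
  have h2 := mul_mul_polarDet_pos a' b' c' a'' b'' c'' hT hU
  have h3 := mul_mul_polarDet_pos a b c a'' b'' c'' hS hU
  have ha : a ≠ 0 := by rintro rfl; nlinarith [sq_nonneg b]
  have ha' : a' ≠ 0 := by rintro rfl; nlinarith [sq_nonneg b']
  have ha'' : a'' ≠ 0 := by rintro rfl; nlinarith [sq_nonneg b'']
  have hsq : 0 < (a * a' * a'') ^ 2 := by positivity
  have key := mul_pos (mul_pos h1 h2) h3
  have : a * a' * (a * c' + c * a' - 2 * (b * b')) * (a' * a'' * (a' * c'' + c' * a'' - 2 * (b' * b''))) *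
      (a * a'' * (a * c'' + c * a'' - 2 * (b * b'')))
      = ((a * c' + c * a' - 2 * (b * b')) * (a' * c'' + c' * a'' - 2 * (b' * b'')) *
        (a * c'' + c * a'' - 2 * (b * b''))) * (a * a' * a'') ^ 2 := by ring
  rw [this] at key
  exact (mul_pos_iff_of_pos_right hsq).mp key


/-- Parity bookkeeping: three reals whose twists `(−1)^{rᵢ} βᵢ` are all positive and `r₁ + r₂ + r₃` odd have
negative product. [folklore] -/
theorem prod_neg_of_pos_twists_odd {β₁ β₂ β₃ : ℝ} {r₁ r₂ r₃ : ℕ} (h1 : 0 < (-1 : ℝ) ^ r₁ * β₁)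
    (h2 : 0 < (-1 : ℝ) ^ r₂ * β₂) (h3 : 0 < (-1 : ℝ) ^ r₃ * β₃) (hodd : Odd (r₁ + r₂ + r₃)) :
    β₁ * β₂ * β₃ < 0 := by
  have key := mul_pos (mul_pos h1 h2) h3
  have : (-1 : ℝ) ^ r₁ * β₁ * ((-1 : ℝ) ^ r₂ * β₂) * ((-1 : ℝ) ^ r₃ * β₃)
      = (-1 : ℝ) ^ (r₁ + r₂ + r₃) * (β₁ * β₂ * β₃) := by rw [pow_add, pow_add]; ring
  rw [this, hodd.neg_one_pow] at key
  linarith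

/-- Parity bookkeeping: three reals whose twists `(−1)^{rᵢ} βᵢ` are all negative and `r₁ + r₂ + r₃` even have
negative product. [folklore] -/
theorem prod_neg_of_neg_twists_even {β₁ β₂ β₃ : ℝ} {r₁ r₂ r₃ : ℕ} (h1 : (-1 : ℝ) ^ r₁ * β₁ < 0)
    (h2 : (-1 : ℝ) ^ r₂ * β₂ < 0) (h3 : (-1 : ℝ) ^ r₃ * β₃ < 0) (heven : Even (r₁ + r₂ + r₃)) :
    β₁ * β₂ * β₃ < 0 := by
  have key := mul_neg_of_pos_of_neg (mul_pos_of_neg_of_neg h1 h2) h3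
  have : (-1 : ℝ) ^ r₁ * β₁ * ((-1 : ℝ) ^ r₂ * β₂) * ((-1 : ℝ) ^ r₃ * β₃)
      = (-1 : ℝ) ^ (r₁ + r₂ + r₃) * (β₁ * β₂ * β₃) := by rw [pow_add, pow_add]; ring
  rw [this, heven.neg_one_pow] at key
  linarith

/-- At `m = 2` the `m`-fold sumset of `d` (indexed by maps `Fin 2 → Fin K`, as in `…CensusSupportDescartes`) is the
set of pair sums. [folklore] -/
theorem sumset_two_eq_pairSums {K : ℕ} (d : Fin K → ℕ) :
    (Finset.univ : Finset (Fin 2 → Fin K)).image (fun f => ∑ i, d (f i))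
      = (Finset.univ : Finset (Fin K × Fin K)).image (fun p => d p.1 + d p.2) := by
  ext e
  simp only [Finset.mem_image, Finset.mem_univ, true_and, Fin.sum_univ_two]
  constructor
  · rintro ⟨f, rfl⟩; exact ⟨(f 0, f 1), rfl⟩
  · rintro ⟨p, rfl⟩; exact ⟨![p.1, p.2], by simp⟩

/-- **C22 — the SIGN-CLASS (parity–Minkowski) support certificate, kernel schema at `m = 2`.**  Let
`F = ∑ l, X^{d l} • S l` be a real symmetric `2 × 2` lacunary pencil on the exponent vector `d`, `W` the set of
pair sums `d a + d b` (the support of `det F` at most).  Suppose two «odd definite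
triangles» are given — letters `i₁, j₁, k₁` and `i₂, j₂, k₂` whose diagonal exponents `2d` and pairwise sums are
UNCOLLIDED in `W`, with `rank (2 d ·)` all even on the first triangle and all odd on the second, and the three pair
ranks of odd sum on the first, of even sum on the second (`rank e = #{x ∈ W : x < e}`).  Then `#Z₊(det F) + 2 ≤ #W`:
the pencil misses its own support-level Descartes bound `#W − 1` by at least one.  (Proof = the cell's LAYER1-SIGNCLASS argument: `#Σ − 1`
positive roots ⇒ full support and full alternation (F1, `pow_rank_mul_coeff_mul_coeff_pos_of_sharp`), so
`sign c_e = s(−1)^{rank e}`; on uncollided exponents `c_{2dᵢ} = det Sᵢ`, `c_{dᵢ+dⱼ} = 2B(Sᵢ,Sⱼ)` (F0); for `s = +`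
the first triangle consists of definite letters (F2) whose three `B`'s would have signs of odd product, against
`sign B(Sᵢ,Sⱼ) = σᵢσⱼ` (F3) — and symmetrically for `s = −`.)  All hypotheses on `d` are decidable, so every line
«`ζ(2,K;d) ≤ D(d) − 1`» of the cell's table `ub_2-6_L1-signclass_*.jsonl` (4 586 supports, four implementations) is an
instance by `decide`. [folklore] -/
theorem card_posRoots_add_two_le_of_signClass {K : ℕ} (d : Fin K → ℕ) (N : ℕ)
    (hN : ((Finset.univ : Finset (Fin K × Fin K)).image (fun p => d p.1 + d p.2)).card = N)
    (i₁ j₁ k₁ i₂ j₂ k₂ : Fin K)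
    (hne : i₁ ≠ j₁ ∧ j₁ ≠ k₁ ∧ i₁ ≠ k₁ ∧ i₂ ≠ j₂ ∧ j₂ ≠ k₂ ∧ i₂ ≠ k₂)
    (u₁ : ∀ p : Fin K × Fin K, d p.1 + d p.2 = d i₁ + d i₁ → p = (i₁, i₁))
    (u₂ : ∀ p : Fin K × Fin K, d p.1 + d p.2 = d j₁ + d j₁ → p = (j₁, j₁))
    (u₃ : ∀ p : Fin K × Fin K, d p.1 + d p.2 = d k₁ + d k₁ → p = (k₁, k₁))
    (u₄ : ∀ p : Fin K × Fin K, d p.1 + d p.2 = d i₁ + d j₁ → p = (i₁, j₁) ∨ p = (j₁, i₁))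
    (u₅ : ∀ p : Fin K × Fin K, d p.1 + d p.2 = d j₁ + d k₁ → p = (j₁, k₁) ∨ p = (k₁, j₁))
    (u₆ : ∀ p : Fin K × Fin K, d p.1 + d p.2 = d i₁ + d k₁ → p = (i₁, k₁) ∨ p = (k₁, i₁))
    (u₇ : ∀ p : Fin K × Fin K, d p.1 + d p.2 = d i₂ + d i₂ → p = (i₂, i₂))
    (u₈ : ∀ p : Fin K × Fin K, d p.1 + d p.2 = d j₂ + d j₂ → p = (j₂, j₂))
    (u₉ : ∀ p : Fin K × Fin K, d p.1 + d p.2 = d k₂ + d k₂ → p = (k₂, k₂))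
    (u₁₀ : ∀ p : Fin K × Fin K, d p.1 + d p.2 = d i₂ + d j₂ → p = (i₂, j₂) ∨ p = (j₂, i₂))
    (u₁₁ : ∀ p : Fin K × Fin K, d p.1 + d p.2 = d j₂ + d k₂ → p = (j₂, k₂) ∨ p = (k₂, j₂))
    (u₁₂ : ∀ p : Fin K × Fin K, d p.1 + d p.2 = d i₂ + d k₂ → p = (i₂, k₂) ∨ p = (k₂, i₂))
    (hpar₁ : let W := (Finset.univ : Finset (Fin K × Fin K)).image (fun p => d p.1 + d p.2)
      Even ((W.filter (· < d i₁ + d i₁)).card) ∧ Even ((W.filter (· < d j₁ + d j₁)).card) ∧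
        Even ((W.filter (· < d k₁ + d k₁)).card) ∧
        Odd ((W.filter (· < d i₁ + d j₁)).card + (W.filter (· < d j₁ + d k₁)).card +
          (W.filter (· < d i₁ + d k₁)).card))
    (hpar₂ : let W := (Finset.univ : Finset (Fin K × Fin K)).image (fun p => d p.1 + d p.2)
      Odd ((W.filter (· < d i₂ + d i₂)).card) ∧ Odd ((W.filter (· < d j₂ + d j₂)).card) ∧
        Odd ((W.filter (· < d k₂ + d k₂)).card) ∧
        Even ((W.filter (· < d i₂ + d j₂)).card + (W.filter (· < d j₂ + d k₂)).card +
          (W.filter (· < d i₂ + d k₂)).card))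
    (S : Fin K → Matrix (Fin 2) (Fin 2) ℝ) (hS : ∀ l, (S l).IsSymm) :
    ((∑ l, ((X : ℝ[X]) ^ d l) • (S l).map C).det.roots.toFinset.filter (fun t => 0 < t)).card + 2 ≤ N := by
  subst hN
  obtain ⟨hij₁, hjk₁, hik₁, hij₂, hjk₂, hik₂⟩ := hne
  obtain ⟨he_i₁, he_j₁, he_k₁, ho₁⟩ := hpar₁
  obtain ⟨ho_i₂, ho_j₂, ho_k₂, he₂⟩ := hpar₂
  set P := (∑ l, ((X : ℝ[X]) ^ d l) • (S l).map C).det with hP_def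
  set W := (Finset.univ : Finset (Fin K × Fin K)).image (fun p => d p.1 + d p.2) with hW_def
  have memW : ∀ a b : Fin K, d a + d b ∈ W := fun a b =>
    Finset.mem_image.mpr ⟨(a, b), Finset.mem_univ _, rfl⟩
  have h2W : 2 ≤ W.card := by
    have hdist : d i₁ + d i₁ ≠ d i₁ + d j₁ := by
      intro h
      have := u₁ (i₁, j₁) h.symm
      exact hij₁ (Prod.mk.inj this).2.symm
    exact Finset.one_lt_card.mpr ⟨_, memW i₁ i₁, _, memW i₁ j₁, hdist⟩
  by_contra hcon
  have hP : P ≠ 0 := by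
    intro h0
    have : (P.roots.toFinset.filter (fun t => 0 < t)).card = 0 := by rw [h0]; simp
    omega
  have hZ : W.card ≤ (P.roots.toFinset.filter (fun t => 0 < t)).card + 1 := by omega
  have hsupp : P.support = W := by
    have hsub : P.support ⊆ W := by
      rw [hP_def, hW_def, ← sumset_two_eq_pairSums d]; exact support_det_pencil_subset_sumset d S
    refine Finset.eq_of_subset_of_card_le hsub ?_
    have h := Literature.Computability.AlgebraicComplexity.card_roots_toFinset_filter_pos_lt_card_support hP
    omega
  have hZ' : P.support.card ≤ (P.roots.toFinset.filter (fun t => 0 < t)).card + 1 := by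
    rw [hsupp]; exact hZ
  -- F1 in rank form (ranks over `W = supp P`)
  have F1 : ∀ a b : ℕ, a ∈ W → b ∈ W →
      0 < (-1 : ℝ) ^ ((W.filter (· < a)).card + (W.filter (· < b)).card) * (P.coeff a * P.coeff b) := by
    intro a b ha hb
    have := pow_rank_mul_coeff_mul_coeff_pos_of_sharp P hZ' (by rw [hsupp]; exact ha) (by rw [hsupp]; exact hb)
    rwa [hsupp] at this
  -- the dictionary (F0) on the twelve uncollided exponents, in entry coordinates
  have hsym : ∀ l, S l 1 0 = S l 0 1 := fun l => by
    have h := congrFun (congrFun (hS l) 1) 0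
    simp only [Matrix.transpose_apply] at h
    exact h.symm
  have hdiag : ∀ i : Fin K, (∀ p : Fin K × Fin K, d p.1 + d p.2 = d i + d i → p = (i, i)) →
      P.coeff (d i + d i) = S i 0 0 * S i 1 1 - S i 0 1 ^ 2 := by
    intro i hu; rw [hP_def, coeff_det_pencil_two_diag d S i hu, hsym, sq]
  have hpair : ∀ i j : Fin K, i ≠ j →
      (∀ p : Fin K × Fin K, d p.1 + d p.2 = d i + d j → p = (i, j) ∨ p = (j, i)) →
      P.coeff (d i + d j) = S i 0 0 * S j 1 1 + S i 1 1 * S j 0 0 - 2 * (S i 0 1 * S j 0 1) := by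
    intro i j hij hu; rw [hP_def, coeff_det_pencil_two_pair d S hij hu, hsym, hsym]; ring
  -- reference sign `s = (−1)^{rank e₀} c_{e₀}` at `e₀ = 2 d i₁`
  set e₀ := d i₁ + d i₁ with he₀
  have twist : ∀ e : ℕ, e ∈ W →
      0 < ((-1 : ℝ) ^ (W.filter (· < e₀)).card * P.coeff e₀) * ((-1 : ℝ) ^ (W.filter (· < e)).card * P.coeff e) := by
    intro e he
    have := F1 e₀ e (memW i₁ i₁) he
    rw [pow_add] at this
    linarith [this]
  have hs0 : (-1 : ℝ) ^ (W.filter (· < e₀)).card * P.coeff e₀ ≠ 0 := by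
    intro h; have := twist e₀ (memW i₁ i₁); rw [h, zero_mul] at this; exact lt_irrefl _ this
  rcases lt_or_gt_of_ne hs0 with hneg | hpos
  · -- global sign `s = −`: the second triangle is definite
    have tw : ∀ e : ℕ, e ∈ W → (-1 : ℝ) ^ (W.filter (· < e)).card * P.coeff e < 0 := by
      intro e he
      have := twist e he
      nlinarith [this, hneg]
    have hdet : ∀ i : Fin K, (∀ p : Fin K × Fin K, d p.1 + d p.2 = d i + d i → p = (i, i)) →
        Odd (W.filter (· < d i + d i)).card → 0 < S i 0 0 * S i 1 1 - S i 0 1 ^ 2 := by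
      intro i hu ho
      have := tw _ (memW i i)
      rw [ho.neg_one_pow, hdiag i hu] at this
      linarith
    have hb : ∀ i j : Fin K, i ≠ j →
        (∀ p : Fin K × Fin K, d p.1 + d p.2 = d i + d j → p = (i, j) ∨ p = (j, i)) →
        (-1 : ℝ) ^ (W.filter (· < d i + d j)).card *
          (S i 0 0 * S j 1 1 + S i 1 1 * S j 0 0 - 2 * (S i 0 1 * S j 0 1)) < 0 := by
      intro i j hij hu
      have := tw _ (memW i j)
      rwa [hpair i j hij hu] at this
    have hΔi := hdet i₂ u₇ ho_i₂
    have hΔj := hdet j₂ u₈ ho_j₂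
    have hΔk := hdet k₂ u₉ ho_k₂
    have hβij := hb i₂ j₂ hij₂ u₁₀
    have hβjk := hb j₂ k₂ hjk₂ u₁₁
    have hβik := hb i₂ k₂ hik₂ u₁₂
    have hprod := prod_neg_of_neg_twists_even hβij hβjk hβik he₂
    have htri := polarDet_triangle_pos (S i₂ 0 0) (S i₂ 0 1) (S i₂ 1 1) (S j₂ 0 0) (S j₂ 0 1) (S j₂ 1 1)
      (S k₂ 0 0) (S k₂ 0 1) (S k₂ 1 1) hΔi hΔj hΔk
    linarith
  · -- global sign `s = +`: the first triangle is definite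
    have tw : ∀ e : ℕ, e ∈ W → 0 < (-1 : ℝ) ^ (W.filter (· < e)).card * P.coeff e := by
      intro e he
      have := twist e he
      exact (mul_pos_iff_of_pos_left hpos).mp this
    have hdet : ∀ i : Fin K, (∀ p : Fin K × Fin K, d p.1 + d p.2 = d i + d i → p = (i, i)) →
        Even (W.filter (· < d i + d i)).card → 0 < S i 0 0 * S i 1 1 - S i 0 1 ^ 2 := by
      intro i hu he
      have := tw _ (memW i i)
      rw [he.neg_one_pow, hdiag i hu] at this
      linarith
    have hb : ∀ i j : Fin K, i ≠ j →
        (∀ p : Fin K × Fin K, d p.1 + d p.2 = d i + d j → p = (i, j) ∨ p = (j, i)) →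
        0 < (-1 : ℝ) ^ (W.filter (· < d i + d j)).card *
          (S i 0 0 * S j 1 1 + S i 1 1 * S j 0 0 - 2 * (S i 0 1 * S j 0 1)) := by
      intro i j hij hu
      have := tw _ (memW i j)
      rwa [hpair i j hij hu] at this
    have hΔi := hdet i₁ u₁ he_i₁
    have hΔj := hdet j₁ u₂ he_j₁
    have hΔk := hdet k₁ u₃ he_k₁
    have hβij := hb i₁ j₁ hij₁ u₄
    have hβjk := hb j₁ k₁ hjk₁ u₅
    have hβik := hb i₁ k₁ hik₁ u₆
    have hprod := prod_neg_of_pos_twists_odd hβij hβjk hβik ho₁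
    have htri := polarDet_triangle_pos (S i₁ 0 0) (S i₁ 0 1) (S i₁ 1 1) (S j₁ 0 0) (S j₁ 0 1) (S j₁ 1 1)
      (S k₁ 0 0) (S k₁ 0 1) (S k₁ 1 1) hΔi hΔj hΔk
    linarith


/-- **Instance (table line, kernel):** on the Sidon support `d = (0,2,5,11,18,28)` every real symmetric `2 × 2`
pencil has `Z₊ ≤ 19 < 20 = D(2,6)` — the worked example of LAYER1-SIGNCLASS-lead.md (triangles `{0,1,5}` /
`{2,3,4}`). [folklore] -/
theorem posRoots_le_19_on_2_6_0_2_5_11_18_28 (S : Fin 6 → Matrix (Fin 2) (Fin 2) ℝ) (hS : ∀ l, (S l).IsSymm) :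
    ((∑ l, ((X : ℝ[X]) ^ (![0, 2, 5, 11, 18, 28] : Fin 6 → ℕ) l) • (S l).map C).det.roots.toFinset.filter
      (fun t => 0 < t)).card ≤ 19 := by
  have h := card_posRoots_add_two_le_of_signClass (![0, 2, 5, 11, 18, 28] : Fin 6 → ℕ) 21 (by decide)
    0 1 5 2 3 4 (by decide) (by decide) (by decide) (by decide) (by decide) (by decide) (by decide) (by decide)
    (by decide) (by decide) (by decide) (by decide) (by decide) (by decide) (by decide) S hS
  omega


end Summit.ValiantsHypothesis.ValiantsHypothesis.Theorems.LacunarySymmetroidMatrixDescartes.Census
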